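import Summits.MatrixMultiplication.MatrixMultiplication.Theorems.SaturationLadderFrontierDefect
import Summits.MatrixMultiplication.MatrixMultiplication.Theorems.SaturationLadderUniformCorners
import HarnessLib

/-!
# Saturation ladder — Kernel XXIV: the UNIFORM defect ladder and sharp exponential saturation

Cell `decomp-mm`, lens `decomp-mm-lens-1` (grading / quantitative ladder), gen 52; supports the
deciding crux `SubexpSaturation` (item 25909) of `route-MatrixMultiplication-SaturationLadder`.
No new hypotheses, no `sorry`.

Kernel XXIII graded PIECE 1 (`SubexpSaturation`) by the EVENTUAL defect: piece 1 `⟺ Δ(r) → 0`,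
`Δ(r) := (1 − τ_ℂ(r))·log r`, and the tree's rung is `limsup Δ ≤ c₂ = 1.0650…`.  This kernel grades
the SUMMIT itself by the UNIFORM defect.  For `C > 0` let

  `U(C) :⟺ ∀ t ∈ [0,1), ∃ r ∈ [1, e^{C/(1−t)}], ω(1,t,r) ≤ 1 + r`

(the rate clause of `SubexpSaturation` at `C` with onset `t₀ = 0`).  Then (§5, §6)

* `U(C) ⟺ ∀ r ≥ 1, Δ(r) ≤ C` (`uniformClause_iff_defect`); `U` is monotone in `C`; `U(C) ⟹` the
  clause of piece 1 at `C`; every eventual clause yields SOME uniform one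
  (`exists_uniformClause_of_clause`);
* **`ω = 2 ⟺ ∀ C > 0, U(C)`** (`matrixMultiplication_iff_uniformClause`) — the summit is the foot of
  the uniform ladder exactly as piece 1 is the foot of the eventual one; `¬(ω = 2) ⟺ ∃ r > 1, Δ(r) > 0`
  (one finite shape) while `¬SubexpSaturation ⟺ ∃ κ > 0, Δ > κ frequently at ∞`
  (`not_matrixMultiplication_iff`, `not_subexpSaturation_iff`);
* the frontier `τ_ℂ` is CONCAVE on `[0, ∞)` (`frontier_concaveOn`; Lotti–Romani convexity read on
  the attained frontier of Kernel XXII).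

The quantitative theorem (§4; certificates in Kernel XXIV-A `SaturationLadderUniformCorners`) is the
rung where this ladder's theorems stop today:

  **`U(log 4)` holds: every `t ∈ [0,1)` is tight at some `r ∈ [1, 4^{1/(1−t)}]`**
  (`uniformClause_log_four`, `sharpExpSaturation`; equivalently `τ_ℂ(r) ≥ 1 − log 4/log r` for all
  `r > 1`, `Δ ≤ log 4` on `[1,∞)`, `σ(t) ≤ 4^{1/(1−t)}`) — item `ExpSaturation` (25913,
  `expSaturation_holds`: `r ≤ 16·4^{1/(1−t)}`) without its factor `16`.  Proof: the corners
  `P_k = (k/(k+1), r_k)`, `r_k ≤ 3·4^k·k/(k+1)` of Kernel XXIV-A and the CHORDS between consecutive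
  corners (convexity of the tight region), which stay below `4^{1/(1−t)}` by the chord bound
  `chord_len_le`; on `[0, 1/2]` the chord from `(0,1)` to `(1/2, 9/2)`.

`log 4` is the supremum of `(1−t)·log r` over the level-`1` corner-and-chord profile, so `U(C)` for
`C < log 4` needs the higher families (twins, class atoms) with EXPLICIT onsets plus a finite window
of certificates; below the class floor `c⋆ = 1.0645…` it meets the same wall as piece 1.

[novel: the uniform/eventual split of the defect ladder, `ω = 2 ⟺ ∀ C > 0, U(C)`, and the chord proof
of the sharp base `4` are this lineage's; convexity is Lotti–Romani 1983, the frontier and its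
threshold property are Kernel XXII, the change of variable is Kernel XXIII.]
-/


set_option linter.dupNamespace false

namespace Summit.MatrixMultiplication.MatrixMultiplication.Theorems.SaturationLadderUniformDefect

open Literature.Computability.AlgebraicComplexity
open Summit.MatrixMultiplication.MatrixMultiplication.Theses.SaturationLadder
open Summit.MatrixMultiplication.MatrixMultiplication.Theorems.SaturationLadderTowerLimit
open Summit.MatrixMultiplication.MatrixMultiplication.Theorems.SaturationLadderExpSaturation
open Summit.MatrixMultiplication.MatrixMultiplication.Theorems.SaturationLadderChordLadder
open Summit.MatrixMultiplication.MatrixMultiplication.Theorems.SaturationLadderFrontierDefect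
open Summit.MatrixMultiplication.MatrixMultiplication.Theorems.SaturationLadderUniformCorners
open Filter Topology

noncomputable section

/-! ## §4 Sharp exponential saturation: `U(log 4)` -/

/-- **`U(log 4)` — the uniform clause at `C = log 4` (onset `t₀ = 0`).**  For every `t ∈ [0,1)` there
is `r ∈ [1, e^{log 4/(1−t)}] = [1, 4^{1/(1−t)}]` with `ω(1,t,r) ≤ 1 + r`.  Segment `[0, 1/2]`: the
chord from `(0,1)` (`ω(1,0,1) = 2`) to `(1/2, 9/2)`; segment `[k/(k+1), (k+1)/(k+2)]`, `k ≥ 1`: the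
chord between the corners of §2, bounded by §3. [folklore] -/
theorem uniformClause_log_four :
    ∀ t : ℝ, 0 ≤ t → t < 1 → ∃ r : ℝ, 1 ≤ r ∧ r ≤ Real.exp (Real.log 4 / (1 - t)) ∧
      omegaRect ℂ 1 t r ≤ 1 + r := by
  intro t ht0 ht1
  have h1t : 0 < 1 - t := by linarith
  have hL1 := log_four_gt
  have hL0 : 0 < Real.log 4 := by linarith
  rcases le_or_gt t (1 / 2) with h | h
  · -- the first segment
    have h01 : omegaRect ℂ 1 0 1 ≤ 1 + 1 := by rw [omegaRect_one_zero_one ℂ]; norm_num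
    have hc := tight_convexComb (t₁ := 0) (r₁ := 1) (t₂ := 1 / 2) (r₂ := 9 / 2) (a := 1 - 2 * t)
      (b := 2 * t) le_rfl zero_le_one (by norm_num) (by norm_num) (by linarith) (by linarith) (by ring)
      h01 tight_half_nineHalves
    have e1 : (1 - 2 * t) * 0 + 2 * t * (1 / 2) = t := by ring
    have e2 : (1 - 2 * t) * 1 + 2 * t * (9 / 2) = 1 + 7 * t := by ring
    rw [e1, e2] at hc
    refine ⟨1 + 7 * t, by linarith, ?_, hc⟩
    -- `1 + 7t ≤ 4(1 + t log 4) ≤ 4·e^{t log 4} = e^{(1+t) log 4} ≤ e^{log 4/(1−t)}`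
    have harg : (1 + t) * Real.log 4 ≤ Real.log 4 / (1 - t) := by
      rw [le_div_iff₀ h1t]
      nlinarith [sq_nonneg t]
    have ht' := Real.add_one_le_exp (t * Real.log 4)
    have hm : t * 1.3862 ≤ t * Real.log 4 := mul_le_mul_of_nonneg_left hL1.le ht0
    calc 1 + 7 * t ≤ 4 * (t * Real.log 4 + 1) := by linarith
      _ ≤ 4 * Real.exp (t * Real.log 4) := by linarith
      _ = Real.exp ((1 + t) * Real.log 4) := by
          rw [show (1 + t) * Real.log 4 = Real.log 4 + t * Real.log 4 by ring, Real.exp_add,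
            Real.exp_log (by norm_num : (0 : ℝ) < 4)]
      _ ≤ Real.exp (Real.log 4 / (1 - t)) := Real.exp_le_exp.2 harg
  · -- the grade `k = ⌊t/(1−t)⌋ ≥ 1` and the chord between the corners `k`, `k+1`
    set y : ℝ := t / (1 - t) with hydef
    have hy0 : 0 ≤ y := div_nonneg ht0 h1t.le
    have hy1 : 1 ≤ y := by rw [hydef, le_div_iff₀ h1t]; linarith
    set k : ℕ := ⌊y⌋₊ with hkdef
    have hk : 1 ≤ k := Nat.le_floor (by exact_mod_cast hy1)
    have hky : (k : ℝ) ≤ y := Nat.floor_le hy0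
    have hyk : y < (k : ℝ) + 1 := Nat.lt_floor_add_one y
    set K : ℝ := (k : ℝ) with hKdef
    have hK1 : (1 : ℝ) ≤ K := by rw [hKdef]; exact_mod_cast hk
    -- `K/(K+1) ≤ t < (K+1)/(K+2)`
    have htk : K / (K + 1) ≤ t := by
      rw [div_le_iff₀ (by positivity)]
      have : K * (1 - t) ≤ t := by rwa [hydef, le_div_iff₀ h1t] at hky
      linarith
    have htk1 : t < (K + 1) / (K + 1 + 1) := by
      rw [lt_div_iff₀ (by positivity)]
      have : t < (K + 1) * (1 - t) := by rwa [hydef, div_lt_iff₀ h1t] at hyk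
      linarith
    -- chord parameter
    set s : ℝ := (t - K / (K + 1)) * ((K + 1) * (K + 2)) with hsdef
    have hs0 : 0 ≤ s := mul_nonneg (by linarith) (by positivity)
    have hs1 : s ≤ 1 := by
      rw [hsdef]
      have h' : t * (K + 1 + 1) < K + 1 := (lt_div_iff₀ (by positivity)).1 htk1
      have e : (t - K / (K + 1)) * ((K + 1) * (K + 2)) = t * (K + 1) * (K + 2) - K * (K + 2) := by
        field_simp
      rw [e]
      nlinarith
    have hts : (1 - s) * (K / (K + 1)) + s * ((K + 1) / (K + 1 + 1)) = t := by
      rw [hsdef]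
      field_simp
      ring
    obtain ⟨r₁, h1r₁, hr₁R, hT₁⟩ := corner k hk
    obtain ⟨r₂, h1r₂, hr₂R, hT₂⟩ := corner (k + 1) (by omega)
    push_cast at hr₂R hT₂
    have hc := tight_convexComb (a := 1 - s) (b := s) (by positivity) (by linarith) (by positivity)
      (by linarith) (by linarith) hs0 (by ring) hT₁ hT₂
    rw [hts] at hc
    have h1r : 1 ≤ (1 - s) * r₁ + s * r₂ := by
      nlinarith [mul_nonneg (sub_nonneg.2 hs1) (sub_nonneg.2 h1r₁), mul_nonneg hs0 (sub_nonneg.2 h1r₂)]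
    refine ⟨(1 - s) * r₁ + s * r₂, h1r, ?_, hc⟩
    have hbound := chord_len_le k hs0 hs1
    rw [hts] at hbound
    calc (1 - s) * r₁ + s * r₂
        ≤ (1 - s) * (3 * (4 : ℝ) ^ k * K / (K + 1)) +
            s * (3 * (4 : ℝ) ^ (k + 1) * (K + 1) / (K + 1 + 1)) :=
          add_le_add (mul_le_mul_of_nonneg_left hr₁R (by linarith)) (mul_le_mul_of_nonneg_left hr₂R hs0)
      _ ≤ Real.exp (Real.log 4 / (1 - t)) := hbound

/-- **SHARP EXPONENTIAL SATURATION.**  For every `t ∈ [0,1)` there is `r ∈ [1, 4^{1/(1−t)}]` with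
`ω(1,t,r) ≤ 1 + r` — item `ExpSaturation` (25913: `r ≤ 16·4^{1/(1−t)}`) without the factor `16`.
[cite: AlmanDuanVassilevskaWilliamsXuXuZhou2025, Thm. 3.2] [cite: LottiRomani1983, §1 (p. 173)] -/
theorem sharpExpSaturation :
    ∀ t : ℝ, 0 ≤ t → t < 1 → ∃ r : ℝ, 1 ≤ r ∧ r ≤ (4 : ℝ) ^ (1 / (1 - t)) ∧
      omegaRect ℂ 1 t r ≤ 1 + r := by
  intro t ht0 ht1
  obtain ⟨r, h1, h2, h3⟩ := uniformClause_log_four t ht0 ht1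
  refine ⟨r, h1, ?_, h3⟩
  rw [Real.rpow_def_of_pos (by norm_num : (0 : ℝ) < 4), mul_one_div]
  exact h2

/-- **Frontier form**: `τ_ℂ(r) ≥ 1 − log 4/log r` for every `r > 1`. [folklore] -/
theorem frontier_ge_one_sub_log_four_div {r : ℝ} (hr : 1 < r) :
    1 - Real.log 4 / Real.log r ≤ sSup {t : ℝ | omegaRect ℂ 1 t r ≤ 1 + r} := by
  have hlog : 0 < Real.log r := Real.log_pos hr
  have hr0 : 0 ≤ r := by linarith
  rcases le_or_gt r 4 with h4 | h4
  · have hle : Real.log r ≤ Real.log 4 := Real.log_le_log (by linarith) h4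
    have h1 : 1 ≤ Real.log 4 / Real.log r := by rw [le_div_iff₀ hlog]; linarith
    linarith [frontier_nonneg hr0]
  · have hlt : Real.log 4 < Real.log r := Real.log_lt_log (by norm_num) h4
    have hL0 : 0 < Real.log 4 := Real.log_pos (by norm_num)
    set t : ℝ := 1 - Real.log 4 / Real.log r with htdef
    have ht0 : 0 ≤ t := by
      have : Real.log 4 / Real.log r ≤ 1 := (div_le_one hlog).2 hlt.le
      rw [htdef]; linarith
    have ht1 : t < 1 := by
      have : 0 < Real.log 4 / Real.log r := div_pos hL0 hlog
      rw [htdef]; linarith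
    obtain ⟨r', -, hr'le, hT⟩ := uniformClause_log_four t ht0 ht1
    have e1t : 1 - t = Real.log 4 / Real.log r := by rw [htdef]; ring
    have he : Real.exp (Real.log 4 / (1 - t)) = r := by
      rw [e1t, div_div_cancel₀ hL0.ne', Real.exp_log (by linarith)]
    rw [he] at hr'le
    exact (tight_iff_le_frontier hr0 t).1 (thinTight_of_len_le ℂ hr'le hT)

/-- **Uniform defect bound**: `Δ(r) = (1 − τ_ℂ(r))·log r ≤ log 4` for every `r ≥ 1` (Kernel XXIII had
only the eventual `limsup Δ ≤ c₂`). [folklore] -/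
theorem frontierDefect_le_log_four {r : ℝ} (hr : 1 ≤ r) :
    (1 - sSup {t : ℝ | omegaRect ℂ 1 t r ≤ 1 + r}) * Real.log r ≤ Real.log 4 := by
  have hL0 : 0 ≤ Real.log 4 := Real.log_nonneg (by norm_num)
  rcases eq_or_lt_of_le hr with h | h
  · rw [← h, Real.log_one, mul_zero]
    exact hL0
  · have hlog : 0 < Real.log r := Real.log_pos h
    have h1 := frontier_ge_one_sub_log_four_div h
    have h2 : 1 - sSup {t : ℝ | omegaRect ℂ 1 t r ≤ 1 + r} ≤ Real.log 4 / Real.log r := by linarith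
    exact (le_div_iff₀ hlog).1 h2

/-- **Saturation-length form**: `σ(t) = min {r ≥ 1 | ω(1,t,r) ≤ 1+r} ≤ 4^{1/(1−t)}` on `[0,1)`.
[folklore] -/
theorem satLength_le_four_rpow {t : ℝ} (ht0 : 0 ≤ t) (ht1 : t < 1) :
    sInf {r : ℝ | 1 ≤ r ∧ omegaRect ℂ 1 t r ≤ 1 + r} ≤ (4 : ℝ) ^ (1 / (1 - t)) := by
  obtain ⟨r, h1, h2, h3⟩ := sharpExpSaturation t ht0 ht1
  have hbdd : BddBelow {r : ℝ | 1 ≤ r ∧ omegaRect ℂ 1 t r ≤ 1 + r} := ⟨1, fun r hr => hr.1⟩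
  have hmem : r ∈ {r : ℝ | 1 ≤ r ∧ omegaRect ℂ 1 t r ≤ 1 + r} := ⟨h1, h3⟩
  exact (csInf_le hbdd hmem).trans h2

/-! ## §5 The uniform ladder `U(C)` and the summit -/

/-- `U` is monotone in `C`. [folklore] -/
theorem uniformClause_mono {C C' : ℝ} (hCC : C ≤ C')
    (h : ∀ t : ℝ, 0 ≤ t → t < 1 → ∃ r : ℝ, 1 ≤ r ∧ r ≤ Real.exp (C / (1 - t)) ∧
      omegaRect ℂ 1 t r ≤ 1 + r) :
    ∀ t : ℝ, 0 ≤ t → t < 1 → ∃ r : ℝ, 1 ≤ r ∧ r ≤ Real.exp (C' / (1 - t)) ∧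
      omegaRect ℂ 1 t r ≤ 1 + r := by
  intro t ht0 ht1
  obtain ⟨r, h1, h2, h3⟩ := h t ht0 ht1
  exact ⟨r, h1, h2.trans (Real.exp_le_exp.2 (div_le_div_of_nonneg_right hCC (by linarith))), h3⟩

/-- `U(C)` is the rate clause of piece 1 at `C` with onset `t₀ = 0`; in particular it implies that
clause. [folklore] -/
theorem clause_of_uniformClause {C : ℝ}
    (h : ∀ t : ℝ, 0 ≤ t → t < 1 → ∃ r : ℝ, 1 ≤ r ∧ r ≤ Real.exp (C / (1 - t)) ∧
      omegaRect ℂ 1 t r ≤ 1 + r) :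
    ∃ t₀ : ℝ, t₀ < 1 ∧ ∀ t : ℝ, t₀ ≤ t → t < 1 →
      ∃ r : ℝ, 1 ≤ r ∧ r ≤ Real.exp (C / (1 - t)) ∧ omegaRect ℂ 1 t r ≤ 1 + r :=
  ⟨0, zero_lt_one, fun t ht ht1 => h t ht ht1⟩

/-- **`U(C) ⟺ Δ ≤ C` on `[1, ∞)`** (`C > 0`): the uniform clause is a uniform bound on the frontier
defect, exactly as the eventual clause is an eventual one (Kernel XXIII `clause_iff_frontier`).
[folklore] -/
theorem uniformClause_iff_defect {C : ℝ} (hC : 0 < C) :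
    (∀ t : ℝ, 0 ≤ t → t < 1 → ∃ r : ℝ, 1 ≤ r ∧ r ≤ Real.exp (C / (1 - t)) ∧
      omegaRect ℂ 1 t r ≤ 1 + r) ↔
    ∀ r : ℝ, 1 ≤ r → (1 - sSup {t : ℝ | omegaRect ℂ 1 t r ≤ 1 + r}) * Real.log r ≤ C := by
  constructor
  · intro h r hr
    have hr0 : 0 ≤ r := by linarith
    have hτ0 := frontier_nonneg hr0
    have hτ1 := frontier_le_one hr0
    have hlog0 : 0 ≤ Real.log r := Real.log_nonneg hr
    rcases le_or_gt (Real.log r) C with hle | hlt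
    · nlinarith
    · have hlog : 0 < Real.log r := hC.trans hlt
      set t : ℝ := 1 - C / Real.log r with htdef
      have ht0 : 0 ≤ t := by
        have : C / Real.log r ≤ 1 := (div_le_one hlog).2 hlt.le
        rw [htdef]; linarith
      have ht1 : t < 1 := by
        have : 0 < C / Real.log r := div_pos hC hlog
        rw [htdef]; linarith
      obtain ⟨r', -, hr'le, hT⟩ := h t ht0 ht1
      have e1t : 1 - t = C / Real.log r := by rw [htdef]; ring
      have he : Real.exp (C / (1 - t)) = r := by
        rw [e1t, div_div_cancel₀ hC.ne', Real.exp_log (by linarith)]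
      rw [he] at hr'le
      have hτ := (tight_iff_le_frontier hr0 t).1 (thinTight_of_len_le ℂ hr'le hT)
      have e : (1 - t) * Real.log r = C := by
        rw [e1t]
        exact div_mul_cancel₀ C hlog.ne'
      have : (1 - sSup {t : ℝ | omegaRect ℂ 1 t r ≤ 1 + r}) * Real.log r ≤ (1 - t) * Real.log r :=
        mul_le_mul_of_nonneg_right (by linarith) hlog.le
      linarith
  · intro h t ht0 ht1
    have h1t : 0 < 1 - t := by linarith
    set r : ℝ := Real.exp (C / (1 - t)) with hrdef
    have hCt : 0 < C / (1 - t) := div_pos hC h1t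
    have hr1 : 1 ≤ r := Real.one_le_exp hCt.le
    have hlogr : Real.log r = C / (1 - t) := by rw [hrdef, Real.log_exp]
    have hd := h r hr1
    rw [hlogr] at hd
    have h1 : 1 - sSup {t : ℝ | omegaRect ℂ 1 t r ≤ 1 + r} ≤ C / (C / (1 - t)) := by
      rw [le_div_iff₀ hCt]; exact hd
    rw [div_div_cancel₀ hC.ne'] at h1
    exact ⟨r, hr1, le_rfl, (tight_iff_le_frontier (by linarith) t).2 (by linarith)⟩

/-- **Eventual ⟹ some uniform.**  If the rate clause of piece 1 holds at `c ≥ 0` from some onset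
`t₀`, then `U(C)` holds for some `C ≥ c` (`C = max(c, log r₀)` with `r₀` tight at the onset).  So the
uniform ladder is non-empty as soon as the eventual one is, and `inf {C | U(C)} ≥ inf {c | clause(c)}`.
[folklore] -/
theorem exists_uniformClause_of_clause {c : ℝ} (hc : 0 ≤ c)
    (h : ∃ t₀ : ℝ, t₀ < 1 ∧ ∀ t : ℝ, t₀ ≤ t → t < 1 →
      ∃ r : ℝ, 1 ≤ r ∧ r ≤ Real.exp (c / (1 - t)) ∧ omegaRect ℂ 1 t r ≤ 1 + r) :
    ∃ C : ℝ, c ≤ C ∧ ∀ t : ℝ, 0 ≤ t → t < 1 → ∃ r : ℝ, 1 ≤ r ∧ r ≤ Real.exp (C / (1 - t)) ∧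
      omegaRect ℂ 1 t r ≤ 1 + r := by
  obtain ⟨t₀, ht₀, h⟩ := h
  have ht₁ : max t₀ 0 < 1 := max_lt ht₀ one_pos
  obtain ⟨r₀, hr₀1, -, hT₀⟩ := h (max t₀ 0) (le_max_left _ _) ht₁
  have hC0 : 0 ≤ max c (Real.log r₀) := hc.trans (le_max_left _ _)
  refine ⟨max c (Real.log r₀), le_max_left _ _, fun t ht0 ht1 => ?_⟩
  rcases le_or_gt (max t₀ 0) t with hle | hlt
  · obtain ⟨r, hr1, hrle, hT⟩ := h t ((le_max_left _ _).trans hle) ht1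
    exact ⟨r, hr1, hrle.trans (Real.exp_le_exp.2
      (div_le_div_of_nonneg_right (le_max_left _ _) (by linarith))), hT⟩
  · refine ⟨r₀, hr₀1, ?_, thinTight_of_le ℂ hlt.le hT₀⟩
    calc r₀ = Real.exp (Real.log r₀) := (Real.exp_log (by linarith)).symm
      _ ≤ Real.exp (max c (Real.log r₀)) := Real.exp_le_exp.2 (le_max_right _ _)
      _ ≤ Real.exp (max c (Real.log r₀) / (1 - t)) := by
          refine Real.exp_le_exp.2 ?_
          rw [le_div_iff₀ (by linarith)]
          nlinarith

/-- **THE SUMMIT IS THE FOOT OF THE UNIFORM LADDER: `ω = 2 ⟺ ∀ C > 0, U(C)`.**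
(`→`: under `ω = 2` the defect vanishes on `[1,∞)`; `←`: `Δ ≤ C` for all `C > 0` forces `τ_ℂ ≡ 1` on
`(1,∞)`, and the tight set in `r` at `t = 1` is closed, so `(1,1,1)` is tight, `ω ≤ 2`.)  Compare
piece 1 `⟺ ∀ c > 0, clause(c)` (eventual). [folklore] -/
theorem matrixMultiplication_iff_uniformClause :
    _root_.MatrixMultiplication ↔ ∀ C : ℝ, 0 < C →
      ∀ t : ℝ, 0 ≤ t → t < 1 → ∃ r : ℝ, 1 ≤ r ∧ r ≤ Real.exp (C / (1 - t)) ∧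
        omegaRect ℂ 1 t r ≤ 1 + r := by
  constructor
  · intro hS C hC
    rw [uniformClause_iff_defect hC]
    intro r hr
    rw [frontierDefect_eq_zero_of_matrixMultiplication hS hr]
    exact hC.le
  · intro h
    have hT : ∀ r : ℝ, 1 < r → omegaRect ℂ 1 1 r ≤ 1 + r := by
      intro r hr
      have hlog : 0 < Real.log r := Real.log_pos hr
      have hΔ : (1 - sSup {t : ℝ | omegaRect ℂ 1 t r ≤ 1 + r}) * Real.log r ≤ 0 := by
        by_contra hne
        push Not at hne
        have := (uniformClause_iff_defect (half_pos hne)).1 (h _ (half_pos hne)) r hr.le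
        linarith
      have hτ1 : 1 ≤ sSup {t : ℝ | omegaRect ℂ 1 t r ≤ 1 + r} := by
        by_contra hlt
        push Not at hlt
        have : 0 < (1 - sSup {t : ℝ | omegaRect ℂ 1 t r ≤ 1 + r}) * Real.log r :=
          mul_pos (by linarith) hlog
        linarith
      exact (tight_iff_le_frontier (by linarith) 1).2 hτ1
    have hsub : Set.Ioi (1 : ℝ) ⊆ {r : ℝ | omegaRect ℂ 1 1 r ≤ 1 + r} := fun r hr => hT r hr
    have hcl := (isClosed_thinTight_len ℂ 1).closure_subset_iff.2 hsub
    rw [closure_Ioi] at hcl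
    have h11 : omegaRect ℂ 1 1 1 ≤ 1 + 1 := hcl Set.self_mem_Ici
    exact matrixMultiplication_iff_frontier_one.2
      (le_antisymm (frontier_le_one zero_le_one) ((tight_iff_le_frontier zero_le_one 1).1 h11))

/-- **`¬(ω = 2) ⟺` the defect is positive at SOME length `r > 1`** (one finite shape), whereas
`¬SubexpSaturation ⟺` the defect stays `≥ κ > 0` at arbitrarily LARGE lengths
(`not_subexpSaturation_iff`). [folklore] -/
theorem not_matrixMultiplication_iff :
    ¬ _root_.MatrixMultiplication ↔
      ∃ r : ℝ, 1 < r ∧ 0 < (1 - sSup {t : ℝ | omegaRect ℂ 1 t r ≤ 1 + r}) * Real.log r := by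
  constructor
  · intro hn
    by_contra hall
    push Not at hall
    apply hn
    rw [matrixMultiplication_iff_uniformClause]
    intro C hC
    rw [uniformClause_iff_defect hC]
    intro r hr
    rcases eq_or_lt_of_le hr with e | hlt
    · rw [← e, Real.log_one, mul_zero]
      exact hC.le
    · exact (hall r hlt).trans hC.le
  · rintro ⟨r, hr, hΔ⟩ hS
    have := frontierDefect_eq_zero_of_matrixMultiplication hS hr.le
    linarith

/-- **`¬SubexpSaturation ⟺ ∃ κ > 0, Δ(r) > κ` frequently as `r → ∞`** (`limsup Δ > 0`; Kernel XXIII: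
piece 1 `⟺ Δ → 0`). [folklore] -/
theorem not_subexpSaturation_iff :
    ¬ SubexpSaturation ↔ ∃ κ : ℝ, 0 < κ ∧
      ∃ᶠ r in atTop, κ < (1 - sSup {t : ℝ | omegaRect ℂ 1 t r ≤ 1 + r}) * Real.log r := by
  rw [subexpSaturation_iff_frontierDefect]
  push Not
  refine exists_congr fun κ => and_congr_right fun _ => ?_
  rw [Filter.frequently_atTop]

/-! ## §6 The frontier is concave -/

/-- **Concavity of the thin frontier**: `a τ_ℂ(r₁) + b τ_ℂ(r₂) ≤ τ_ℂ(a r₁ + b r₂)` for `r₁, r₂ ≥ 0`,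
`a, b ≥ 0`, `a + b = 1` (convexity of the tight region read on the attained frontier; this is why
chords between certified corners certify the whole frontier above them). [cite: LottiRomani1983, §1 (p. 173)] -/
theorem frontier_concave {r₁ r₂ a b : ℝ} (hr₁ : 0 ≤ r₁) (hr₂ : 0 ≤ r₂) (ha : 0 ≤ a) (hb : 0 ≤ b)
    (hab : a + b = 1) :
    a * sSup {t : ℝ | omegaRect ℂ 1 t r₁ ≤ 1 + r₁} + b * sSup {t : ℝ | omegaRect ℂ 1 t r₂ ≤ 1 + r₂} ≤
      sSup {t : ℝ | omegaRect ℂ 1 t (a * r₁ + b * r₂) ≤ 1 + (a * r₁ + b * r₂)} := by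
  obtain ⟨hT₁, h0₁, -, -⟩ := thinFrontier_attained ℂ hr₁
  obtain ⟨hT₂, h0₂, -, -⟩ := thinFrontier_attained ℂ hr₂
  have hc := tight_convexComb h0₁ hr₁ h0₂ hr₂ ha hb hab hT₁ hT₂
  exact (tight_iff_le_frontier (by positivity) _).1 hc

/-- The frontier as a `ConcaveOn` function on `[0, ∞)`. [cite: LottiRomani1983, §1 (p. 173)] -/
theorem frontier_concaveOn :
    ConcaveOn ℝ (Set.Ici (0 : ℝ)) (fun r : ℝ => sSup {t : ℝ | omegaRect ℂ 1 t r ≤ 1 + r}) := by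
  refine ⟨convex_Ici 0, ?_⟩
  intro r₁ hr₁ r₂ hr₂ a b ha hb hab
  simp only [smul_eq_mul]
  exact frontier_concave hr₁ hr₂ ha hb hab

end

end Summit.MatrixMultiplication.MatrixMultiplication.Theorems.SaturationLadderUniformDefect
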